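import Summits.NavierStokesRegularity.NavierStokesRegularity.Theorems.TerminalTraceExtinctApexPairing
import Literature.Analysis.FluidPDE.SpaceTimeRescaling
import HarnessLib

/-!
# Crux `TerminalTrace.TypeITraceScarL3` (stmt-NavierStokesRegularity-18385), STUB 2 support file 4:
# passing a uniform top-time modulus of the pairings to an `L¹`-limit, and the pairings of
# parabolic zooms (change of variables, Hölder on a ball)

Prover seat nsreg-p4 (gen 15); `--supports stmt-NavierStokesRegularity-18385`.  Theorems only.

* `ae_abs_setIntegral_inner_le_of_tendsto` — if `w_j → W` in `L¹` of a backward parabolic ball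
  `Q(z, R) = I × B`, the pairings `G_j(s) = ∫_B ⟪w_j(s), η⟫` with a bounded field `η` obey
  `|G_j(s) − c_j| ≤ ω(s)` for a.e. `s ∈ I` with `c_j → 0`, then `|∫_B ⟪W(s), η⟫| ≤ ω(s)` for a.e.
  `s ∈ I` (Fubini: `G_j → G` in `L¹(I)`; a subsequence converges a.e.);
* `integral_inner_zoom_eq` — `∫ ⟪(λ·u)(t₀ + λ²s, x₀ + λy), η(y)⟫ dy
  = λ·λ⁻³ ∫ ⟪u(t₀ + λ²s, x), η(λ⁻¹(x − x₀))⟫ dx`;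
* `abs_setIntegral_inner_le_eLpNorm_three` — `|∫_B ⟪f, η⟫| ≤ K₀ ‖f‖_{L³(B)} |B|^{2/3}`.

These are the bookkeeping steps of «the zoom limit at an `L³` apex has a null weak top trace»
(Seregin, *Lecture notes* (2014), Prop. 6.20 / §6.6 p. 127).

WHAT THIS IS NOT: not a regularity or blow-up claim; the crux and its open stubs are untouched.
-/

noncomputable section

open MeasureTheory Set Function Filter Topology TopologicalSpace Metric
open scoped NNReal ENNReal InnerProductSpace RealInnerProductSpace

namespace Summit.NavierStokesRegularity.NavierStokesRegularity.Theorems.TerminalTraceExtinctApexTopTrace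

open Literature.Analysis Literature.Analysis.FluidPDE
open Summit.NavierStokesRegularity.NavierStokesRegularity.Theorems.TerminalTraceExtinctApexPairing

/-! ## Pairings with fields supported in a set -/

/-- A pairing with a field supported in `S` is the pairing over `S`. -/
theorem setIntegral_inner_eq_integral_of_tsupport_subset
    {f η : EuclideanSpace ℝ (Fin 3) → EuclideanSpace ℝ (Fin 3)} {S : Set (EuclideanSpace ℝ (Fin 3))}
    (hη : tsupport η ⊆ S) :
    ∫ x in S, ⟪f x, η x⟫ = ∫ x, ⟪f x, η x⟫ := by
  refine setIntegral_eq_integral_of_forall_compl_eq_zero fun x hx => ?_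
  rw [image_eq_zero_of_notMem_tsupport fun h => hx (hη h), inner_zero_right]

/-- **Hölder on a ball**: `|∫_B ⟪f, η⟫| ≤ K₀ ‖f‖_{L³(B)} |B|^{2/3}` for `‖η‖ ≤ K₀`. -/
theorem abs_setIntegral_inner_le_eLpNorm_three
    {f η : EuclideanSpace ℝ (Fin 3) → EuclideanSpace ℝ (Fin 3)} {B : Set (EuclideanSpace ℝ (Fin 3))}
    (hf : AEStronglyMeasurable f (volume.restrict B)) (hf3 : eLpNorm f 3 (volume.restrict B) ≠ ⊤)
    (hB : volume B ≠ ⊤) {K₀ : ℝ} (hK₀ : ∀ x, ‖η x‖ ≤ K₀) :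
    |∫ x in B, ⟪f x, η x⟫| ≤
      K₀ * (eLpNorm f 3 (volume.restrict B) * volume B ^ (2 / 3 : ℝ)).toReal := by
  have hK : 0 ≤ K₀ := (norm_nonneg _).trans (hK₀ 0)
  rw [← Real.norm_eq_abs]
  refine (norm_integral_le_lintegral_norm _).trans ?_
  have h1 : ∫⁻ x in B, ENNReal.ofReal ‖⟪f x, η x⟫‖ ≤ ENNReal.ofReal K₀ * ∫⁻ x in B, ‖f x‖ₑ := by
    rw [← lintegral_const_mul' _ _ ENNReal.ofReal_ne_top]
    refine lintegral_mono fun x => ?_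
    rw [← ofReal_norm, ← ENNReal.ofReal_mul hK]
    refine ENNReal.ofReal_le_ofReal ?_
    calc ‖⟪f x, η x⟫‖ ≤ ‖f x‖ * ‖η x‖ := norm_inner_le_norm _ _
      _ ≤ ‖f x‖ * K₀ := by gcongr; exact hK₀ x
      _ = K₀ * ‖f x‖ := mul_comm _ _
  have h2 : ∫⁻ x in B, ‖f x‖ₑ ≤ eLpNorm f 3 (volume.restrict B) * volume B ^ (2 / 3 : ℝ) := by
    have h := eLpNorm_le_eLpNorm_mul_rpow_measure_univ (μ := volume.restrict B)
      (p := 1) (q := (3 : ℝ≥0∞)) (by norm_num) hf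
    rw [Measure.restrict_apply_univ, eLpNorm_one_eq_lintegral_enorm] at h
    have hexp : (1 / (1 : ℝ≥0∞).toReal - 1 / (3 : ℝ≥0∞).toReal : ℝ) = 2 / 3 := by
      rw [ENNReal.toReal_one, ENNReal.toReal_ofNat]; norm_num
    rwa [hexp] at h
  have hfin : ENNReal.ofReal K₀ * (eLpNorm f 3 (volume.restrict B) * volume B ^ (2 / 3 : ℝ)) ≠ ⊤ :=
    ENNReal.mul_ne_top ENNReal.ofReal_ne_top
      (ENNReal.mul_ne_top hf3 (ENNReal.rpow_ne_top_of_nonneg (by norm_num) hB))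
  calc (∫⁻ x in B, ENNReal.ofReal ‖⟪f x, η x⟫‖).toReal
      ≤ (ENNReal.ofReal K₀ * (eLpNorm f 3 (volume.restrict B) * volume B ^ (2 / 3 : ℝ))).toReal :=
        ENNReal.toReal_mono hfin (h1.trans (mul_le_mul' le_rfl h2))
    _ = K₀ * (eLpNorm f 3 (volume.restrict B) * volume B ^ (2 / 3 : ℝ)).toReal := by
        rw [ENNReal.toReal_mul, ENNReal.toReal_ofReal hK]

/-! ## Pairings of parabolic zooms -/

/-- **Change of variables for the pairings of a parabolic zoom**:
`∫ ⟪(λ·u)(t₀ + λ² s, x₀ + λ y), η(y)⟫ dy = λ (λ³)⁻¹ ∫ ⟪u(t₀ + λ² s, x), η(λ⁻¹ (x − x₀))⟫ dx`. -/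
theorem integral_inner_zoom_eq (u : ℝ → EuclideanSpace ℝ (Fin 3) → EuclideanSpace ℝ (Fin 3))
    (η : EuclideanSpace ℝ (Fin 3) → EuclideanSpace ℝ (Fin 3)) {c : ℝ} (hc : 0 < c) (t₀ : ℝ)
    (x₀ : EuclideanSpace ℝ (Fin 3)) (s : ℝ) :
    ∫ y, ⟪(c • stPull (c ^ 2) c t₀ x₀ u) s y, η y⟫ =
      c * (c ^ 3)⁻¹ * ∫ x, ⟪u (t₀ + c ^ 2 * s) x, η (c⁻¹ • (x - x₀))⟫ := by
  have h := integral_comp_space_affine hc x₀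
    (fun x => ⟪u (t₀ + c ^ 2 * s) x, η (c⁻¹ • (x - x₀))⟫)
  rw [finrank_euclideanSpace_fin] at h
  have e : (fun y : EuclideanSpace ℝ (Fin 3) => ⟪(c • stPull (c ^ 2) c t₀ x₀ u) s y, η y⟫) =
      fun y => c * ⟪u (t₀ + c ^ 2 * s) (x₀ + c • y), η (c⁻¹ • (x₀ + c • y - x₀))⟫ := by
    funext y
    rw [smul_stPull_apply, real_inner_smul_left, add_sub_cancel_left, smul_smul,
      inv_mul_cancel₀ hc.ne', one_smul]
  rw [e, integral_const_mul, h, smul_eq_mul, mul_assoc]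

/-- The zoomed test field `η(λ⁻¹(x − x₀))` is smooth and compactly supported. -/
theorem contDiff_hasCompactSupport_comp_zoom {η : EuclideanSpace ℝ (Fin 3) → EuclideanSpace ℝ (Fin 3)}
    (hη : ContDiff ℝ (⊤ : ℕ∞) η) (hηc : HasCompactSupport η) {c : ℝ} (hc : 0 < c)
    (x₀ : EuclideanSpace ℝ (Fin 3)) :
    ContDiff ℝ (⊤ : ℕ∞) (fun x => η (c⁻¹ • (x - x₀))) ∧
      HasCompactSupport (fun x => η (c⁻¹ • (x - x₀))) := by
  refine ⟨hη.comp ((contDiff_id.sub contDiff_const).const_smul c⁻¹), ?_⟩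
  have e : (fun x : EuclideanSpace ℝ (Fin 3) => η (c⁻¹ • (x - x₀))) =
      η ∘ spaceAffineHomeomorph (inv_pos.2 hc).ne' (-(c⁻¹ • x₀)) := by
    funext x
    rw [Function.comp_apply, spaceAffineHomeomorph_apply, smul_sub, neg_add_eq_sub]
  rw [e]
  exact hηc.comp_homeomorph _

/-! ## Passing a uniform top modulus to an `L¹` limit -/

/-- **A uniform top-time modulus survives `L¹` limits.**  On a backward parabolic ball
`Q(z, R) = I × B` let `w_j → W` in `L¹(Q(z, R))` (all integrable there), `η` a continuous field
with `‖η‖ ≤ K₀`, `c_j → 0`, and suppose `|∫_B ⟪w_j(s), η⟫ − c_j| ≤ ω(s)` for a.e. `s ∈ I` and every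
`j`.  Then `|∫_B ⟪W(s), η⟫| ≤ ω(s)` for a.e. `s ∈ I`: by Fubini the pairings converge in `L¹(I)`,
hence a.e. along a subsequence. -/
theorem ae_abs_setIntegral_inner_le_of_tendsto {z : ℝ × EuclideanSpace ℝ (Fin 3)} {R : ℝ}
    {w : ℕ → ℝ → EuclideanSpace ℝ (Fin 3) → EuclideanSpace ℝ (Fin 3)}
    {W : ℝ → EuclideanSpace ℝ (Fin 3) → EuclideanSpace ℝ (Fin 3)}
    (hw : ∀ j, IntegrableOn (uncurry (w j)) (parabolicCylinder R z) volume)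
    (hW : IntegrableOn (uncurry W) (parabolicCylinder R z) volume)
    (hconv : Tendsto (fun j => ∫⁻ q in parabolicCylinder R z, ‖uncurry (w j) q - uncurry W q‖ₑ)
      atTop (𝓝 0))
    {η : EuclideanSpace ℝ (Fin 3) → EuclideanSpace ℝ (Fin 3)} (hηc : Continuous η) {K₀ : ℝ}
    (hK₀ : ∀ x, ‖η x‖ ≤ K₀) {c : ℕ → ℝ} (hc : Tendsto c atTop (𝓝 0)) {ω : ℝ → ℝ}
    (hbd : ∀ j, ∀ᵐ s ∂(volume.restrict (Ioo (z.1 - R ^ 2) z.1)),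
      |(∫ x in ball z.2 R, ⟪w j s x, η x⟫) - c j| ≤ ω s) :
    ∀ᵐ s ∂(volume.restrict (Ioo (z.1 - R ^ 2) z.1)), |∫ x in ball z.2 R, ⟪W s x, η x⟫| ≤ ω s := by
  have hK : 0 ≤ K₀ := (norm_nonneg _).trans (hK₀ 0)
  set I : Set ℝ := Ioo (z.1 - R ^ 2) z.1 with hI
  set B : Set (EuclideanSpace ℝ (Fin 3)) := ball z.2 R with hB
  set μ : Measure ℝ := volume.restrict I with hμ
  set ν : Measure (EuclideanSpace ℝ (Fin 3)) := volume.restrict B with hν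
  have hprod : (volume : Measure (ℝ × EuclideanSpace ℝ (Fin 3))).restrict (parabolicCylinder R z) =
      μ.prod ν := volume_restrict_parabolicCylinder R z
  -- the pairings
  set G : ℕ → ℝ → ℝ := fun j s => ∫ x in B, ⟪w j s x, η x⟫ with hG
  set GW : ℝ → ℝ := fun s => ∫ x in B, ⟪W s x, η x⟫ with hGW
  -- integrability on the product and of the pairings
  have hw' : ∀ j, Integrable (uncurry (w j)) (μ.prod ν) := fun j => by rw [← hprod]; exact hw j
  have hW' : Integrable (uncurry W) (μ.prod ν) := by rw [← hprod]; exact hW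
  have hdiff : ∀ j, Integrable (fun q : ℝ × EuclideanSpace ℝ (Fin 3) =>
      ⟪uncurry (w j) q - uncurry W q, η q.2⟫) (μ.prod ν) := by
    intro j
    have hd := (hw' j).sub hW'
    refine Integrable.mono' (hd.norm.mul_const K₀)
      (hd.1.inner (hηc.comp continuous_snd).aestronglyMeasurable) (Eventually.of_forall fun q => ?_)
    exact (norm_inner_le_norm _ _).trans (mul_le_mul_of_nonneg_left (hK₀ q.2) (norm_nonneg _))
  have hpair : ∀ (f : ℝ → EuclideanSpace ℝ (Fin 3) → EuclideanSpace ℝ (Fin 3)),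
      Integrable (uncurry f) (μ.prod ν) →
      Integrable (fun q : ℝ × EuclideanSpace ℝ (Fin 3) => ⟪f q.1 q.2, η q.2⟫) (μ.prod ν) := by
    intro f hf
    refine Integrable.mono' (hf.norm.mul_const K₀)
      (hf.1.inner (hηc.comp continuous_snd).aestronglyMeasurable) (Eventually.of_forall fun q => ?_)
    exact (norm_inner_le_norm _ _).trans (mul_le_mul_of_nonneg_left (hK₀ q.2) (norm_nonneg _))
  have hGm : ∀ j, AEStronglyMeasurable (G j) μ := fun j =>
    ((hpair (w j) (hw' j)).integral_prod_left).aestronglyMeasurable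
  have hGWm : AEStronglyMeasurable GW μ := ((hpair W hW').integral_prod_left).aestronglyMeasurable
  -- `‖G_j(s) - GW(s)‖ₑ ≤ K₀ ∫_B ‖w_j(s) - W(s)‖` for a.e. `s`
  have hptw : ∀ j, ∀ᵐ s ∂μ, ‖G j s - GW s‖ₑ ≤
      ENNReal.ofReal K₀ * ∫⁻ x in B, ‖w j s x - W s x‖ₑ := by
    intro j
    filter_upwards [(hpair (w j) (hw' j)).prod_right_ae, (hpair W hW').prod_right_ae] with s h1 h2
    have e : G j s - GW s = ∫ x in B, ⟪w j s x - W s x, η x⟫ := by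
      rw [hG, hGW]
      dsimp only
      rw [← integral_sub h1 h2]
      refine integral_congr_ae (Eventually.of_forall fun x => ?_)
      simp only [inner_sub_left]
    have h12 : Integrable (fun x => ⟪w j s x - W s x, η x⟫) ν :=
      (h1.sub h2).congr (Eventually.of_forall fun x => by simp only [Pi.sub_apply, inner_sub_left])
    rw [e, ← ofReal_norm, ← lintegral_const_mul' _ _ ENNReal.ofReal_ne_top]
    refine (ENNReal.ofReal_le_ofReal (norm_integral_le_integral_norm _)).trans ?_
    rw [ofReal_integral_eq_lintegral_ofReal h12.norm (Eventually.of_forall fun _ => norm_nonneg _)]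
    refine lintegral_mono fun x => ?_
    rw [← ofReal_norm, ← ENNReal.ofReal_mul hK]
    refine ENNReal.ofReal_le_ofReal ?_
    calc ‖⟪w j s x - W s x, η x⟫‖ ≤ ‖w j s x - W s x‖ * ‖η x‖ := norm_inner_le_norm _ _
      _ ≤ ‖w j s x - W s x‖ * K₀ := by gcongr; exact hK₀ x
      _ = K₀ * ‖w j s x - W s x‖ := mul_comm _ _
  -- hence `G_j → GW` in `L¹(I)`
  have hL1 : Tendsto (fun j => eLpNorm (G j - GW) 1 μ) atTop (𝓝 0) := by
    have hle : ∀ j, eLpNorm (G j - GW) 1 μ ≤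
        ENNReal.ofReal K₀ * ∫⁻ q in parabolicCylinder R z, ‖uncurry (w j) q - uncurry W q‖ₑ := by
      intro j
      have hmeas : AEMeasurable (fun q : ℝ × EuclideanSpace ℝ (Fin 3) =>
          ‖uncurry (w j) q - uncurry W q‖ₑ) (μ.prod ν) := ((hw' j).sub hW').1.enorm
      rw [eLpNorm_one_eq_lintegral_enorm, hprod, lintegral_prod _ hmeas,
        ← lintegral_const_mul' _ _ ENNReal.ofReal_ne_top]
      exact lintegral_mono_ae (hptw j)
    have h0 : Tendsto (fun j => ENNReal.ofReal K₀ *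
        ∫⁻ q in parabolicCylinder R z, ‖uncurry (w j) q - uncurry W q‖ₑ) atTop (𝓝 0) := by
      have h := ENNReal.Tendsto.const_mul hconv (Or.inr ENNReal.ofReal_ne_top) (a := ENNReal.ofReal K₀)
      rwa [mul_zero] at h
    exact tendsto_of_tendsto_of_tendsto_of_le_of_le tendsto_const_nhds h0 (fun _ => bot_le) hle
  -- a subsequence converges a.e.
  obtain ⟨ψ, hψ, hae⟩ :=
    (tendstoInMeasure_of_tendsto_eLpNorm one_ne_zero hGm hGWm hL1).exists_seq_tendsto_ae
  have hall : ∀ᵐ s ∂μ, ∀ j, |G j s - c j| ≤ ω s := ae_all_iff.2 hbd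
  filter_upwards [hae, hall] with s hs hs'
  have hlim : Tendsto (fun i => |G (ψ i) s - c (ψ i)|) atTop (𝓝 (|GW s - 0|)) :=
    (hs.sub (hc.comp hψ.tendsto_atTop)).abs
  rw [sub_zero] at hlim
  exact le_of_tendsto' hlim fun i => hs' (ψ i)

end Summit.NavierStokesRegularity.NavierStokesRegularity.Theorems.TerminalTraceExtinctApexTopTrace

end
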